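import Literature.Analysis.FunctionSpaces.TorusAnalyticSeminorm
import Literature.Analysis.FunctionSpaces.TorusAnalyticTransport
import HarnessLib

/-!
# Composition, transport and flow estimates for the analyticity seminorms `⟦·⟧_{n,R}` (Armstrong–Vicol, App. A) — cited facts

Analysis/FunctionSpaces file of NAMED FACTS (`def … : Prop`, each the statement of a theorem PROVED in
the cited source; no proofs here, by the cell tenure's ruling D24-12, 2026-08-28: "(α) GO — cited named
facts over `Torus.dnorm`, constants as printed, complete hypotheses, a debt row per fact").
Source: S. Armstrong, V. Vicol, *Anomalous diffusion by fractal homogenization*, Ann. PDE 11 (2025),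
arXiv:2305.05048; Appendix A "Faà di Bruno formula and its consequences" = §7 of the arXiv version,
pp. 70–74 of the materialised copy (`~/.lit/texts/paper-arxiv-2305.05048/p0070–p0074`). The seminorms
are `⟦f⟧_{n,R} = (n+1)²/(n! Rⁿ) sup_{|α|=n} ‖∂^α f‖_∞` ((A.1); `Torus.dnorm`, file
`TorusAnalyticSeminorm`, where Lemma 7.1 (products) is PROVED).

The facts, in the tree's torus vocabulary (periodic functions = functions on `T^d = UnitAddTorus d`;
a periodic self-map of `ℝ^d` of the form `x ↦ x + D(x)` = the torus map `y ↦ y + proj (D y)` with a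
displacement `D : T^d → ℝ^d`, exactly as the Lagrangian flow maps `X = id + proj ∘ disp` of
`FluidPDE/LagrangianLatticeCarrier`; words `l : List d` of directions = multi-indices):

* `ArmstrongVicol2025_composition` — Prop. 7.6 (composition estimate): `⟦h ∘ g⟧_{n,R} ≤ C_h`,
  `R = R_g (1 + d C_g R_h)`;
* `ArmstrongVicol2025_transportShift` — Lemma 7.7 (the solution `Y` of `(∂ₜ + f·∇)Y = g`, `Y(0) = 0`):
  `⟦Y(t)⟧_{n,R_Y(t)} ≤ 8 d C_g |t|` for `|t| ≤ T = 1/(4 d C_f R_f)`, `R_Y(t) = R_g + 4|t| d C_f R_f²`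
  — **ERRATUM: FALSE AS PRINTED for `R_g ≫ R_f`** (see the docstring; do not use as a hypothesis;
  refuted in the kernel for `d = Fin 1` by
  `Torus.TransportShiftRefutation.not_ArmstrongVicol2025_transportShift` of
  `TorusAnalyticTransportShiftRefutation`); the corrected statement, radius `R_g(1 + 4|t| d C_f R_f)`, is
  the THEOREM `Torus.dnorm_transportShift_le` of `TorusAnalyticTransport`, from which Cor. 7.8 below is
  discharged;
* `ArmstrongVicol2025_transportShift_grad` — Cor. 7.8: `⟦∇Y(t)⟧_{n,R_g(1+4|t|dC_fR_f)²} ≤ 4dC_gR_g/(C_fR_f)`;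
* `ArmstrongVicol2025_flowGrad_comp_inv` — Prop. 7.10 (second display): for the flow `X` of a
  divergence-free `f`, `⟦(∇X)(t, X⁻¹(t,·))⟧_{n,R_f(1+4|t|dC_fR_f)²} ≤ (d−1)!(20d)^{d−1}`, `0 ≤ n ≤ N−1`;
* `ArmstrongVicol2025_flowGrad` — Prop. 7.11: `⟦∇X(t)⟧_{n,8dR_f(1+8dC_fR_f|t|)} ≤ 6d`, `1 ≤ n ≤ N−1`.

NORM-CONVENTION HEDGE (so that no fact is stronger than the source under either reading of `‖∂^α g‖_∞`
for VECTOR-valued `g` in (A.1) — Euclidean norm of the vector, or maximum over components): hypotheses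
on vector fields are imposed with the Euclidean norm (`Torus.dnorm` of the `ℝ^d`-valued function, the
larger quantity), conclusions on vector/matrix fields are asserted componentwise (`Torus.dnorm` of each
scalar component, the smaller quantity). Scalar statements (Prop. 7.6's `h`) are unaffected. Time
dependence `L^∞_t` in the source is pointwise in `t` and is rendered by quantifying over `t`. Regularity
hypotheses are taken as `C^∞` (jointly in `(t,x)` where the source differentiates in `t`), which only
strengthens hypotheses.

## Debt (discharge route for each fact; tenure D24-12 (iii))

* all five: AV App. A Prop. 7.2 (multivariate Faà di Bruno) + Lemmas 7.3–7.5 (the resummation bounds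
  (e.vomit.again.1–3)) ≈ 400 lines of combinatorics over `Torus.iterPartialDeriv` words (or Mathlib's
  `OrderedFinpartition` Faà di Bruno, `Mathlib.Analysis.Calculus.ContDiff.FaaDiBruno`), then:
  Prop. 7.6 = p. 71 (10 lines given 7.2–7.5); Lemma 7.7 = pp. 72 (induction on `n` along characteristics,
  Grönwall); Cor. 7.8 = p. 72 (from 7.7 and the derivative shift `Torus.dnorm_partialDeriv_le`);
  Prop. 7.10 = p. 73 (Grönwall for `∇X − Id`, cofactor formula, Lemma 7.1 = `Torus.dnorm_mul_le`);
  Prop. 7.11 = pp. 73–74 ("chain rule on steroids" (eq:chain:rule:steroids), induction on `n`).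

## References

* S. Armstrong, V. Vicol, Ann. PDE 11 (2025), arXiv:2305.05048, App. A: (A.1), Prop. 7.6, Lemma 7.7,
  Cor. 7.8, Prop. 7.10, Prop. 7.11 (arXiv numbering). [`ArmstrongVicol2025`]
-/

noncomputable section

open Set Function

namespace Literature.Analysis.FunctionSpaces

namespace Torus

/-- **Armstrong–Vicol, App. A Prop. 7.6 (composition estimate)**, p. 71 of arXiv:2305.05048: let
`h ∈ L^∞(C^m(ℝ^d))` and `g ∈ L^∞(C^m(ℝ^d))^d`, and assume there are `C_h, C_g, R_h, R_g ∈ (0,∞)` with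
`⟦h⟧_{n,R_h} ≤ C_h` for all `0 ≤ n ≤ m` and `⟦g⟧_{n,R_g} ≤ C_g` for all `1 ≤ n ≤ m`. Then for every
`0 ≤ n ≤ m`, `⟦h ∘ g⟧_{n,R} ≤ C_h` where `R = R_g (1 + d C_g R_h)`.
Torus rendering: `h : T^d → ℝ` smooth, `g = id + D` with a smooth displacement `D : T^d → ℝ^d`, so
`h ∘ g = (y ↦ h (y + proj (D y)))`, `∂ⱼg = eⱼ + ∂ⱼD` (order `1`) and `∂^α g = ∂^α D` (`|α| ≥ 2`); the
`g`-hypotheses use the Euclidean norm of the vector (hedge, see the file header).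
[cite: ArmstrongVicol2025, App. A Prop. 7.6 (arXiv §7 p. 71, "Composition estimate")] -/
def ArmstrongVicol2025_composition (d : Type*) [Fintype d] [DecidableEq d] : Prop :=
  ∀ (m : ℕ) (h : UnitAddTorus d → ℝ) (D : UnitAddTorus d → EuclideanSpace ℝ d) (Ch Cg Rh Rg : ℝ),
    0 < Ch → 0 < Cg → 0 < Rh → 0 < Rg → IsSmooth h → IsSmooth D →
    (∀ n, n ≤ m → dnorm n Rh h ≤ Ch) →
    (1 ≤ m → ∀ (j : d) (y : UnitAddTorus d), 4 / Rg * ‖EuclideanSpace.single j (1 : ℝ) + partialDeriv j D y‖ ≤ Cg) →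
    (∀ n, 2 ≤ n → n ≤ m → dnorm n Rg D ≤ Cg) →
    ∀ n, n ≤ m →
      dnorm n (Rg * (1 + (Fintype.card d : ℝ) * Cg * Rh)) (fun y => h (y + proj (D y))) ≤ Ch

/-- **Armstrong–Vicol, App. A Lemma 7.7 (transport: regularity shift)**, p. 72: for smooth
`f, g : ℝ × ℝ^d → ℝ^d` let `Y` solve `(∂ₜ + f·∇) Y = g` in `ℝ × ℝ^d`, `Y(0,·) = 0` ((e.transport)). Assume
there are `C_f, R_f, C_g, R_g > 0` with `R_f ≤ R_g` (the inequality between the two radii is the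
one that makes the displayed bound `R_Y(t) ≤ R_g(1 + 4|t| d C_f R_f)` hold) and `N ∈ ℕ` such that
`max_{1≤n≤N} sup_t ⟦f(t,·)⟧_{n,R_f} ≤ C_f` and `max_{1≤n≤N} sup_t ⟦g(t,·)⟧_{n,R_g} ≤ C_g` ((e.bear.salmon.1)).
Then `max_{1≤n≤N} sup_{t∈[−T,T]} |t|⁻¹ ⟦Y(t,·)⟧_{n,R_Y(t)} ≤ 8 d C_g`, where
`R_Y(t) := R_g + 4|t| d C_f R_f² (≤ R_g(1 + 4|t| d C_f R_f))` and `T := 1/(4 d C_f R_f)` ((e.bear.salmon.2)).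
Torus rendering: `f, g, Y : ℝ → T^d → ℝ^d` jointly smooth, the equation pointwise
(`∂ₜY = g − (f·∇)Y`, `Torus.convect`), hypotheses with Euclidean norms, conclusion componentwise and in
the form `⟦Yᵢ(t)⟧ ≤ 8dC_g|t|` (hedge, see the file header).

**ERRATUM (this statement is FALSE AS PRINTED; kept verbatim as the record of the source, with no
consumer — never take `(h : ArmstrongVicol2025_transportShift d)` as a hypothesis, everything downstream
of it is vacuous).** Counterexample (`d = 1`, so `Fintype.card d = 1`): `f(t,x) = −(a/2π) sin(2πx)` with
`a = 5`, `R_f = 20`, `C_f = 1` (then `⟦f⟧_{n,20} ≤ 1` for all `n ≥ 1`), `T = 1/(4 d C_f R_f) = 1/80`;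
`g(t,x) = c cos(λx) e₁` with `λ = 2πm ≥ N R_g` and `c` chosen so that `max_{1≤n≤N} ⟦g⟧_{n,R_g} = C_g`;
letting `R_g → ∞` (with `m → ∞`), `⟦Y(T)⟧_{N,R_Y(T)} → C_g (e^{N/16} − 1)/(N a)`, which exceeds the
asserted `8 d C_g T = C_g/10` for every even `N ≥ 56` (the flow of `f` contracts towards `x = 0` at rate `a`, and the
printed radius `R_Y = R_g + 4|t|dC_fR_f²` does not grow proportionally to `R_g`). The printed proof breaks
at the step "`≤ 1/16`" on p. 72: after `∫₀ᵗ s R_Y(s)ⁿ ds ≤ t R_Y(t)^{n+1}/(4d(n+1)C_fR_f²)` the coefficient of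
`sup_s ⟦Y(s)⟧_{n,R_Y(s)}/s` is `n (R_Y(t)^{n+1} − R_g^{n+1})/(16 (n+1) R_f R_Y(t)ⁿ)`-sized, which is `≤ 1/16`
only when `R_g ≲ R_f`, i.e. it is unbounded in the regime `R_g ≫ R_f` that the hypothesis `R_f ≤ R_g`
allows. **Kernel refutation:** `Torus.TransportShiftRefutation.not_ArmstrongVicol2025_transportShift :
¬ ArmstrongVicol2025_transportShift (Fin 1)` (file `TorusAnalyticTransportShiftRefutation`; an explicit witness with
`a = π`, `R_f = 4π`, `C_f = 1`, `g = (1 + cos θ)/((1+μ²) + (1−μ²) cos θ) e₁`, `μ = 10⁴`, `R_g = π(μ+1)`,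
`C_g = 129²`, `N = 128`, whose transport equation is solved in closed form).
**Corrected statement (Lemma 7.7′) = the THEOREM `Torus.dnorm_transportShift_le`** (file
`TorusAnalyticTransport`): the same hypotheses and the same bound `8 d C_g |t|`, at the radius
`R_g (1 + 4|t| d C_f R_f)` (which equals the printed `R_Y(t)` when `R_g = R_f`, the only instance the source
uses downstream: Prop. 7.10 with `g = −f`); Cor. 7.8 (`ArmstrongVicol2025_transportShift_grad`) — whose
printed proof uses only `R_Y(t) ≤ R_g(1 + 4|t|dC_fR_f)` — is discharged from the corrected theorem below
(`ArmstrongVicol2025_transportShift_grad_holds`), so no result of the tree depends on this def.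
[cite: ArmstrongVicol2025, App. A Lemma 7.7 (arXiv §7.2 p. 72, (e.transport), (e.bear.salmon.1)–(e.bear.salmon.2))] -/
def ArmstrongVicol2025_transportShift (d : Type*) [Fintype d] [DecidableEq d] : Prop :=
  ∀ (N : ℕ) (f g Y : ℝ → UnitAddTorus d → EuclideanSpace ℝ d) (Cf Rf Cg Rg : ℝ),
    0 < Cf → 0 < Rf → 0 < Cg → 0 < Rg → Rf ≤ Rg →
    IsSmoothSpaceTimeOn univ f → IsSmoothSpaceTimeOn univ g → IsSmoothSpaceTimeOn univ Y →
    (∀ x, Y 0 x = 0) →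
    (∀ t x, HasDerivAt (fun s => Y s x) (g t x - convect (f t) (Y t) x) t) →
    (∀ n, 1 ≤ n → n ≤ N → ∀ t, dnorm n Rf (f t) ≤ Cf) →
    (∀ n, 1 ≤ n → n ≤ N → ∀ t, dnorm n Rg (g t) ≤ Cg) →
    ∀ n, 1 ≤ n → n ≤ N → ∀ t : ℝ, |t| ≤ 1 / (4 * (Fintype.card d : ℝ) * Cf * Rf) →
      ∀ i : d, dnorm n (Rg + 4 * |t| * (Fintype.card d : ℝ) * Cf * Rf ^ 2) (fun y => Y t y i) ≤
        8 * (Fintype.card d : ℝ) * Cg * |t|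

/-- **Armstrong–Vicol, App. A Cor. 7.8**, p. 72: under the assumptions of Lemma 7.7, for all `|t| ≤ T`
and `0 ≤ n ≤ N − 1`, `⟦∇Y(·,t)⟧_{n,R_{∇Y}(t)} ≤ 4 d C_g R_g/(C_f R_f)` where
`R_{∇Y}(t) = R_g (1 + 4|t| d C_f R_f)²`. Torus rendering as in `ArmstrongVicol2025_transportShift`;
`∇Y` componentwise (`∂ⱼYᵢ`). [cite: ArmstrongVicol2025, App. A Cor. 7.8 (arXiv §7.2 p. 72)] -/
def ArmstrongVicol2025_transportShift_grad (d : Type*) [Fintype d] [DecidableEq d] : Prop :=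
  ∀ (N : ℕ) (f g Y : ℝ → UnitAddTorus d → EuclideanSpace ℝ d) (Cf Rf Cg Rg : ℝ),
    0 < Cf → 0 < Rf → 0 < Cg → 0 < Rg → Rf ≤ Rg →
    IsSmoothSpaceTimeOn univ f → IsSmoothSpaceTimeOn univ g → IsSmoothSpaceTimeOn univ Y →
    (∀ x, Y 0 x = 0) →
    (∀ t x, HasDerivAt (fun s => Y s x) (g t x - convect (f t) (Y t) x) t) →
    (∀ n, 1 ≤ n → n ≤ N → ∀ t, dnorm n Rf (f t) ≤ Cf) →
    (∀ n, 1 ≤ n → n ≤ N → ∀ t, dnorm n Rg (g t) ≤ Cg) →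
    ∀ n, n + 1 ≤ N → ∀ t : ℝ, |t| ≤ 1 / (4 * (Fintype.card d : ℝ) * Cf * Rf) →
      ∀ i j : d, dnorm n (Rg * (1 + 4 * |t| * (Fintype.card d : ℝ) * Cf * Rf) ^ 2)
          (fun y => partialDeriv j (Y t) y i) ≤
        4 * (Fintype.card d : ℝ) * Cg * Rg / (Cf * Rf)

/-- **Armstrong–Vicol, App. A Prop. 7.10 (second display)**, p. 73: suppose `f` is divergence-free and
satisfies (e.bear.salmon.1) (`max_{1≤n≤N} sup_t ⟦f(t,·)⟧_{n,R_f} ≤ C_f`), and let `X` be the solution of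
the flow ODE `∂ₜX(t,x) = f(t, X(t,x))`, `X(0,x) = x` ((e.ODE.flow)), `X⁻¹(t,·)` the inverse flow. Then for
every `t ∈ [−T,T]`, `T = 1/(4dC_fR_f)`, and every `0 ≤ n ≤ N − 1`,
`⟦∇X(t, X⁻¹(t,·))⟧_{n, R_f (1 + 4|t| d C_f R_f)²} ≤ (d−1)! (20d)^{d−1}`.
(The first display of Prop. 7.10, `‖∇X(t,·) − Id‖_∞ ≤ |t| d C_f R_f ≤ 1/4`, is a Grönwall bound and is
not restated here.) Torus rendering: `X(t) = id + proj ∘ D(t)` with a jointly smooth displacement `D`,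
`D(0) = 0`, `∂ₜD(t,x) = f(t, X(t,x))`; `Xinv(t)` a two-sided inverse of `X(t)`; `(∇X)_{ij} = δ_{ij} + ∂ⱼDᵢ`
composed with `Xinv(t)`, componentwise (hedge, see the file header).
[cite: ArmstrongVicol2025, App. A Prop. 7.10 (arXiv §7.3 p. 73, (e.ODE.flow), (eq:grad:psi) ff.)] -/
def ArmstrongVicol2025_flowGrad_comp_inv (d : Type*) [Fintype d] [DecidableEq d] : Prop :=
  ∀ (N : ℕ) (f D : ℝ → UnitAddTorus d → EuclideanSpace ℝ d)
    (Xinv : ℝ → UnitAddTorus d → UnitAddTorus d) (Cf Rf : ℝ),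
    0 < Cf → 0 < Rf →
    IsSmoothSpaceTimeOn univ f → IsSmoothSpaceTimeOn univ D → (∀ t, IsDivFree (f t)) →
    (∀ x, D 0 x = 0) →
    (∀ t x, HasDerivAt (fun s => D s x) (f t (x + proj (D t x))) t) →
    (∀ t x, Xinv t (x + proj (D t x)) = x) → (∀ t y, Xinv t y + proj (D t (Xinv t y)) = y) →
    (∀ n, 1 ≤ n → n ≤ N → ∀ t, dnorm n Rf (f t) ≤ Cf) →
    ∀ n, n + 1 ≤ N → ∀ t : ℝ, |t| ≤ 1 / (4 * (Fintype.card d : ℝ) * Cf * Rf) →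
      ∀ i j : d, dnorm n (Rf * (1 + 4 * |t| * (Fintype.card d : ℝ) * Cf * Rf) ^ 2)
          (fun y => (1 : Matrix d d ℝ) i j + partialDeriv j (fun x => D t x i) (Xinv t y)) ≤
        (Nat.factorial (Fintype.card d - 1) : ℝ) * (20 * (Fintype.card d : ℝ)) ^ (Fintype.card d - 1)

/-- **Armstrong–Vicol, App. A Prop. 7.11 (flow of a field in the class: derivative bounds)**, pp. 73–74:
suppose `f` satisfies (e.bear.salmon.1) (`max_{1≤n≤N} sup_t ⟦f(t,·)⟧_{n,R_f} ≤ C_f`) and let `X` be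
the solution of `∂ₜX(t,x) = f(t,X(t,x))`, `X(0,x) = x` ((e.ODE.flow)). Then for every `t ∈ [−T,T]`,
`T = 1/(4dC_fR_f)`, and every `1 ≤ n ≤ N − 1`,
`⟦∇X(t,·)⟧_{n, 8 d R_f (1 + 8 d C_f R_f |t|)} ≤ 6d` ((e.ODE.flow.estimate)).
Torus rendering: `X(t) = id + proj ∘ D(t)`, `D` jointly smooth, `D(0) = 0`, `∂ₜD(t,x) = f(t,X(t,x))`;
`(∇X)_{ij} = δ_{ij} + ∂ⱼDᵢ` componentwise (hedge, see the file header).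
[cite: ArmstrongVicol2025, App. A Prop. 7.11 (arXiv §7.3 pp. 73–74, (e.ODE.flow.estimate))] -/
def ArmstrongVicol2025_flowGrad (d : Type*) [Fintype d] [DecidableEq d] : Prop :=
  ∀ (N : ℕ) (f D : ℝ → UnitAddTorus d → EuclideanSpace ℝ d) (Cf Rf : ℝ),
    0 < Cf → 0 < Rf →
    IsSmoothSpaceTimeOn univ f → IsSmoothSpaceTimeOn univ D →
    (∀ x, D 0 x = 0) →
    (∀ t x, HasDerivAt (fun s => D s x) (f t (x + proj (D t x))) t) →
    (∀ n, 1 ≤ n → n ≤ N → ∀ t, dnorm n Rf (f t) ≤ Cf) →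
    ∀ n, 1 ≤ n → n + 1 ≤ N → ∀ t : ℝ, |t| ≤ 1 / (4 * (Fintype.card d : ℝ) * Cf * Rf) →
      ∀ i j : d, dnorm n (8 * (Fintype.card d : ℝ) * Rf * (1 + 8 * (Fintype.card d : ℝ) * Cf * Rf * |t|))
          (fun y => (1 : Matrix d d ℝ) i j + partialDeriv j (fun x => D t x i) y) ≤
        6 * (Fintype.card d : ℝ)

/-! ## Cor. 7.8 is a consequence of Lemma 7.7 (proved reduction) -/

/-- **Change of radius**: `⟦u⟧_{n,R'} = (R/R')ⁿ ⟦u⟧_{n,R}` (`R, R' > 0`). [cite: ArmstrongVicol2025, App. A (A.1)] -/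
theorem dnorm_radius_scale {d : Type*} [Fintype d] [DecidableEq d] {F : Type*} [NormedAddCommGroup F]
    [NormedSpace ℝ F] (n : ℕ) {R R' : ℝ} (hR : 0 < R) (hR' : 0 < R') (u : UnitAddTorus d → F) :
    dnorm n R' u = (R / R') ^ n * dnorm n R u := by
  rw [dnorm_def, dnorm_def, div_pow]
  have h1 : (Nat.factorial n : ℝ) ≠ 0 := by exact_mod_cast (Nat.factorial_pos n).ne'
  have h2 : R ^ n ≠ 0 := pow_ne_zero _ hR.ne'
  have h3 : R' ^ n ≠ 0 := pow_ne_zero _ hR'.ne'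
  field_simp

/-- The elementary inequality behind Cor. 7.8: `a (1+a) (n+1)³/(n+2)² ≤ 2 (1+a)ⁿ` for `0 ≤ a ≤ 1`
(`(n+1)³/(n+2)² ≤ n` for `n ≥ 1` and Bernoulli `n a ≤ (1+a)ⁿ`; `n = 0` directly). [cite: ArmstrongVicol2025, App. A Cor. 7.8 (proof, "n a ≤ (1+a)^n")] -/
theorem mul_cube_div_sq_le_two_mul_pow (n : ℕ) {a : ℝ} (ha0 : 0 ≤ a) (ha1 : a ≤ 1) :
    a * (1 + a) * (((n : ℝ) + 1) ^ 3 / ((n : ℝ) + 2) ^ 2) ≤ 2 * (1 + a) ^ n := by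
  have h1a : (1 : ℝ) ≤ 1 + a := by linarith
  rcases Nat.eq_zero_or_pos n with rfl | hn
  · norm_num
    nlinarith
  · -- `(n+1)³ ≤ n (n+2)²`
    have hc : ((n : ℝ) + 1) ^ 3 / ((n : ℝ) + 2) ^ 2 ≤ n := by
      rw [div_le_iff₀ (by positivity)]
      have hn1 : (1 : ℝ) ≤ n := by exact_mod_cast hn
      nlinarith
    -- Bernoulli: `n a ≤ (1+a)^n`
    have hB : (n : ℝ) * a ≤ (1 + a) ^ n := by
      have := one_add_le_pow_of_two_add_nonneg (a := a) (by linarith) n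
      linarith
    calc a * (1 + a) * (((n : ℝ) + 1) ^ 3 / ((n : ℝ) + 2) ^ 2)
        ≤ a * (1 + a) * n := mul_le_mul_of_nonneg_left hc (by positivity)
      _ = (1 + a) * ((n : ℝ) * a) := by ring
      _ ≤ 2 * (1 + a) ^ n := mul_le_mul (by linarith) hB (by positivity) (by norm_num)

/-- **Cor. 7.8 follows from Lemma 7.7** (Armstrong–Vicol's four-line proof, p. 72: the derivative shift
`⟦∂ⱼu⟧_{n,R} ≤ ((n+1)³R/(n+2)²) ⟦u⟧_{n+1,R}`, the change of radius `R_Y(t) → R_g(1+4|t|dC_fR_f)²` and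
`n a ≤ (1+a)ⁿ`), here for the componentwise renderings of both statements.
[cite: ArmstrongVicol2025, App. A Cor. 7.8 (proof, p. 72)] -/
theorem ArmstrongVicol2025_transportShift_grad_of_transportShift (d : Type*) [Fintype d] [DecidableEq d]
    (h77 : ArmstrongVicol2025_transportShift d) : ArmstrongVicol2025_transportShift_grad d := by
  intro N f g Y Cf Rf Cg Rg hCf hRf hCg hRg hRfg hf hg hY hY0 hODE hfb hgb n hn t ht i j
  have hdd1 : (1 : ℝ) ≤ (Fintype.card d : ℝ) := by
    have : 1 ≤ Fintype.card d := Fintype.card_pos_iff.2 ⟨i⟩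
    exact_mod_cast this
  have hdd0 : (0 : ℝ) < (Fintype.card d : ℝ) := by linarith
  -- Lemma 7.7 at order `n + 1` for the component `i`
  have h1 := h77 N f g Y Cf Rf Cg Rg hCf hRf hCg hRg hRfg hf hg hY hY0 hODE hfb hgb (n + 1)
    (Nat.succ_le_succ (Nat.zero_le _)) hn t ht i
  -- opaque abbreviations `a = 4|t| d C_f R_f`, `RY = R_Y(t)`, `R' = R_{∇Y}(t)`
  obtain ⟨dd, hdd⟩ : ∃ r : ℝ, r = (Fintype.card d : ℝ) := ⟨_, rfl⟩
  obtain ⟨a, ha⟩ : ∃ r : ℝ, r = 4 * |t| * (Fintype.card d : ℝ) * Cf * Rf := ⟨_, rfl⟩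
  obtain ⟨RY, hRY⟩ : ∃ r : ℝ, r = Rg + 4 * |t| * (Fintype.card d : ℝ) * Cf * Rf ^ 2 := ⟨_, rfl⟩
  obtain ⟨R', hR'⟩ : ∃ r : ℝ, r = Rg * (1 + 4 * |t| * (Fintype.card d : ℝ) * Cf * Rf) ^ 2 := ⟨_, rfl⟩
  rw [← hRY] at h1
  rw [← hR', ← hdd]
  rw [← hdd] at h1 ht ha hRY hR'
  have hddpos : 0 < dd := by rw [hdd]; exact hdd0
  have hdd1' : (1 : ℝ) ≤ dd := by rw [hdd]; exact hdd1
  have ha0 : 0 ≤ a := by rw [ha]; positivity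
  have ha1 : a ≤ 1 := by
    have hpos : 0 < 4 * dd * Cf * Rf := by positivity
    have h2 := (le_div_iff₀ hpos).1 ht
    rw [ha]
    nlinarith
  have hR'a : R' = Rg * (1 + a) ^ 2 := by rw [hR', ha]
  have hRYa : RY = Rg + a * Rf := by rw [hRY, ha]; ring
  have hRYle : RY ≤ Rg * (1 + a) := by
    rw [hRYa, mul_add, mul_one]
    have : a * Rf ≤ a * Rg := mul_le_mul_of_nonneg_left hRfg ha0
    linarith
  have hRYpos : 0 < RY := by rw [hRYa]; positivity
  have hR'pos : 0 < R' := by rw [hR'a]; positivity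
  -- derivative shift for the scalar component
  have hYi : IsSmooth (fun y => Y t y i) := (hY.isSmooth_slice (mem_univ t)).apply i
  have h2 := dnorm_partialDeriv_le n hRYpos hYi j
  have hcomp : (fun y => partialDeriv j (Y t) y i) = Torus.partialDeriv j (fun y => Y t y i) := by
    funext y
    exact (partialDeriv_apply_coord ((hY.isSmooth_slice (mem_univ t)).isContDiff (n := 1) (by simp)) j y i).symm
  rw [hcomp, dnorm_radius_scale n hRYpos hR'pos]
  -- assemble the chain of AV's proof
  have hw : 0 ≤ ((n : ℝ) + 1) ^ 3 * RY / ((n : ℝ) + 2) ^ 2 := by positivity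
  have h3 : dnorm n RY (Torus.partialDeriv j fun y => Y t y i) ≤
      ((n : ℝ) + 1) ^ 3 * RY / ((n : ℝ) + 2) ^ 2 * (8 * dd * Cg * |t|) :=
    h2.trans (mul_le_mul_of_nonneg_left h1 hw)
  have hratio : 0 ≤ (RY / R') ^ n := by positivity
  refine (mul_le_mul_of_nonneg_left h3 hratio).trans ?_
  have h1a : (1 : ℝ) ≤ 1 + a := by linarith
  -- `(RY/R')ⁿ · RY · (1+a)ⁿ ≤ Rg (1+a)`
  have hpow : (RY / R') ^ n * RY * (1 + a) ^ n ≤ Rg * (1 + a) := by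
    have e : (RY / R') ^ n * RY * (1 + a) ^ n = (RY * (1 + a) / R') ^ n * RY := by
      rw [div_pow, div_pow, mul_pow]; ring
    rw [e]
    have hq : RY * (1 + a) / R' ≤ 1 := by
      rw [div_le_one hR'pos, hR'a, sq]
      calc RY * (1 + a) ≤ Rg * (1 + a) * (1 + a) := mul_le_mul_of_nonneg_right hRYle (by positivity)
        _ = Rg * ((1 + a) * (1 + a)) := by ring
    have hqn : (RY * (1 + a) / R') ^ n ≤ 1 := pow_le_one₀ (by positivity) hq
    calc (RY * (1 + a) / R') ^ n * RY ≤ 1 * RY := mul_le_mul_of_nonneg_right hqn hRYpos.le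
      _ ≤ Rg * (1 + a) := by rw [one_mul]; exact hRYle
  -- `|t| = a / (4 dd Cf Rf)`
  have ht_eq : |t| = a / (4 * dd * Cf * Rf) := by
    rw [ha]; field_simp
  have hkey := mul_cube_div_sq_le_two_mul_pow n ha0 ha1
  rw [ht_eq]
  have hpos1 : (0 : ℝ) < (1 + a) ^ n := by positivity
  have eL : (RY / R') ^ n * (((n : ℝ) + 1) ^ 3 * RY / ((n : ℝ) + 2) ^ 2 * (8 * dd * Cg * (a / (4 * dd * Cf * Rf)))) =
      ((RY / R') ^ n * RY * (1 + a) ^ n) * (a * (1 + a) * (((n : ℝ) + 1) ^ 3 / ((n : ℝ) + 2) ^ 2)) *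
        (2 * Cg / (Cf * Rf)) / ((1 + a) ^ n * (1 + a)) := by
    field_simp
    ring
  rw [eL, div_le_iff₀ (by positivity)]
  calc (RY / R') ^ n * RY * (1 + a) ^ n * (a * (1 + a) * (((n : ℝ) + 1) ^ 3 / ((n : ℝ) + 2) ^ 2)) * (2 * Cg / (Cf * Rf))
      ≤ (Rg * (1 + a)) * (2 * (1 + a) ^ n) * (2 * Cg / (Cf * Rf)) := by
        refine mul_le_mul_of_nonneg_right (mul_le_mul hpow hkey (by positivity) (by positivity)) (by positivity)
    _ = 4 * 1 * Cg * Rg / (Cf * Rf) * ((1 + a) ^ n * (1 + a)) := by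
        field_simp
        ring
    _ ≤ 4 * dd * Cg * Rg / (Cf * Rf) * ((1 + a) ^ n * (1 + a)) := by
        refine mul_le_mul_of_nonneg_right ?_ (by positivity)
        refine div_le_div_of_nonneg_right ?_ (by positivity)
        have : 0 ≤ Cg * Rg := by positivity
        nlinarith

/-! ## Cor. 7.8 discharged (from the corrected Lemma 7.7 of `TorusAnalyticTransport`) -/

/-- **Discharge of `ArmstrongVicol2025_transportShift_grad` (Armstrong–Vicol, App. A Cor. 7.8, as printed).**
The tree's PROVED transport estimate `Torus.dnorm_transportShift_le` (Lemma 7.7 with the radius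
`R_g(1 + 4|t|dC_fR_f)`; file `TorusAnalyticTransport` — the printed radius `R_g + 4|t|dC_fR_f²` of
`ArmstrongVicol2025_transportShift` is false for `R_g ≫ R_f`, so Cor. 7.8 is NOT obtained from that
fact but from the corrected theorem) feeds Armstrong–Vicol's four-line argument (p. 72): derivative
shift `⟦∂ⱼu⟧_{n,R} ≤ ((n+1)³R/(n+2)²) ⟦u⟧_{n+1,R}`, change of radius `R_g(1+a) → R_g(1+a)²`
(`a = 4|t|dC_fR_f ≤ 1`), and `n a ≤ (1+a)ⁿ`. Unconditional; axioms standard.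
[cite: ArmstrongVicol2025, App. A Cor. 7.8 (arXiv §7.2 p. 72, (e.vomit.3))] -/
theorem ArmstrongVicol2025_transportShift_grad_holds :
    ∀ (d : Type*) [Fintype d] [DecidableEq d], ArmstrongVicol2025_transportShift_grad d := by
  intro d _ _ N f g Y Cf Rf Cg Rg hCf hRf hCg hRg hRfg hf hg hY hY0 hODE hfb hgb n hn t ht i j
  have hdd1 : (1 : ℝ) ≤ (Fintype.card d : ℝ) := by
    have : 1 ≤ Fintype.card d := Fintype.card_pos_iff.2 ⟨i⟩
    exact_mod_cast this
  have hdd0 : (0 : ℝ) < (Fintype.card d : ℝ) := by linarith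
  -- the corrected Lemma 7.7 at order `n + 1` for the component `i`
  have h1 := dnorm_transportShift_le N f g Y Cf Rf Cg Rg hCf hRf hCg hRg hRfg hf hg hY hY0 hODE hfb hgb (n + 1)
    (Nat.succ_le_succ (Nat.zero_le _)) hn t ht i
  -- opaque abbreviations `a = 4|t| d C_f R_f`, `RY = R_g (1 + a)`, `R' = R_g (1 + a)²`
  obtain ⟨dd, hdd⟩ : ∃ r : ℝ, r = (Fintype.card d : ℝ) := ⟨_, rfl⟩
  obtain ⟨a, ha⟩ : ∃ r : ℝ, r = 4 * |t| * (Fintype.card d : ℝ) * Cf * Rf := ⟨_, rfl⟩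
  obtain ⟨RY, hRY⟩ : ∃ r : ℝ, r = Rg * (1 + 4 * |t| * (Fintype.card d : ℝ) * Cf * Rf) := ⟨_, rfl⟩
  obtain ⟨R', hR'⟩ : ∃ r : ℝ, r = Rg * (1 + 4 * |t| * (Fintype.card d : ℝ) * Cf * Rf) ^ 2 := ⟨_, rfl⟩
  rw [← hRY] at h1
  rw [← hR', ← hdd]
  rw [← hdd] at h1 ht ha hRY hR'
  have hddpos : 0 < dd := by rw [hdd]; exact hdd0
  have hdd1' : (1 : ℝ) ≤ dd := by rw [hdd]; exact hdd1
  have ha0 : 0 ≤ a := by rw [ha]; positivity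
  have ha1 : a ≤ 1 := by
    have hpos : 0 < 4 * dd * Cf * Rf := by positivity
    have h2 := (le_div_iff₀ hpos).1 ht
    rw [ha]
    nlinarith
  have hR'a : R' = Rg * (1 + a) ^ 2 := by rw [hR', ha]
  have hRYa : RY = Rg * (1 + a) := by rw [hRY, ha]
  have hRYle : RY ≤ Rg * (1 + a) := hRYa.le
  have hRYpos : 0 < RY := by rw [hRYa]; positivity
  have hR'pos : 0 < R' := by rw [hR'a]; positivity
  -- derivative shift for the scalar component
  have hYi : IsSmooth (fun y => Y t y i) := (hY.isSmooth_slice (mem_univ t)).apply i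
  have h2 := dnorm_partialDeriv_le n hRYpos hYi j
  have hcomp : (fun y => partialDeriv j (Y t) y i) = Torus.partialDeriv j (fun y => Y t y i) := by
    funext y
    exact (partialDeriv_apply_coord ((hY.isSmooth_slice (mem_univ t)).isContDiff (n := 1) (by simp)) j y i).symm
  rw [hcomp, dnorm_radius_scale n hRYpos hR'pos]
  -- assemble the chain of AV's proof
  have hw : 0 ≤ ((n : ℝ) + 1) ^ 3 * RY / ((n : ℝ) + 2) ^ 2 := by positivity
  have h3 : dnorm n RY (Torus.partialDeriv j fun y => Y t y i) ≤
      ((n : ℝ) + 1) ^ 3 * RY / ((n : ℝ) + 2) ^ 2 * (8 * dd * Cg * |t|) :=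
    h2.trans (mul_le_mul_of_nonneg_left h1 hw)
  have hratio : 0 ≤ (RY / R') ^ n := by positivity
  refine (mul_le_mul_of_nonneg_left h3 hratio).trans ?_
  have h1a : (1 : ℝ) ≤ 1 + a := by linarith
  -- `(RY/R')ⁿ · RY · (1+a)ⁿ ≤ Rg (1+a)`
  have hpow : (RY / R') ^ n * RY * (1 + a) ^ n ≤ Rg * (1 + a) := by
    have e : (RY / R') ^ n * RY * (1 + a) ^ n = (RY * (1 + a) / R') ^ n * RY := by
      rw [div_pow, div_pow, mul_pow]; ring
    rw [e]
    have hq : RY * (1 + a) / R' ≤ 1 := by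
      rw [div_le_one hR'pos, hR'a, sq]
      calc RY * (1 + a) ≤ Rg * (1 + a) * (1 + a) := mul_le_mul_of_nonneg_right hRYle (by positivity)
        _ = Rg * ((1 + a) * (1 + a)) := by ring
    have hqn : (RY * (1 + a) / R') ^ n ≤ 1 := pow_le_one₀ (by positivity) hq
    calc (RY * (1 + a) / R') ^ n * RY ≤ 1 * RY := mul_le_mul_of_nonneg_right hqn hRYpos.le
      _ ≤ Rg * (1 + a) := by rw [one_mul]; exact hRYle
  -- `|t| = a / (4 dd Cf Rf)`
  have ht_eq : |t| = a / (4 * dd * Cf * Rf) := by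
    rw [ha]; field_simp
  have hkey := mul_cube_div_sq_le_two_mul_pow n ha0 ha1
  rw [ht_eq]
  have hpos1 : (0 : ℝ) < (1 + a) ^ n := by positivity
  have eL : (RY / R') ^ n * (((n : ℝ) + 1) ^ 3 * RY / ((n : ℝ) + 2) ^ 2 * (8 * dd * Cg * (a / (4 * dd * Cf * Rf)))) =
      ((RY / R') ^ n * RY * (1 + a) ^ n) * (a * (1 + a) * (((n : ℝ) + 1) ^ 3 / ((n : ℝ) + 2) ^ 2)) *
        (2 * Cg / (Cf * Rf)) / ((1 + a) ^ n * (1 + a)) := by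
    field_simp
    ring
  rw [eL, div_le_iff₀ (by positivity)]
  calc (RY / R') ^ n * RY * (1 + a) ^ n * (a * (1 + a) * (((n : ℝ) + 1) ^ 3 / ((n : ℝ) + 2) ^ 2)) * (2 * Cg / (Cf * Rf))
      ≤ (Rg * (1 + a)) * (2 * (1 + a) ^ n) * (2 * Cg / (Cf * Rf)) := by
        refine mul_le_mul_of_nonneg_right (mul_le_mul hpow hkey (by positivity) (by positivity)) (by positivity)
    _ = 4 * 1 * Cg * Rg / (Cf * Rf) * ((1 + a) ^ n * (1 + a)) := by
        field_simp
        ring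
    _ ≤ 4 * dd * Cg * Rg / (Cf * Rf) * ((1 + a) ^ n * (1 + a)) := by
        refine mul_le_mul_of_nonneg_right ?_ (by positivity)
        refine div_le_div_of_nonneg_right ?_ (by positivity)
        have : 0 ≤ Cg * Rg := by positivity
        nlinarith

end Torus

end Literature.Analysis.FunctionSpaces

end
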